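import Mathlib
import HarnessLib
import HarnessLib.Audit
import Summits.NavierStokesRegularity.Statement
import Literature.Analysis.FluidPDE.ClassicalSolution
import Literature.Analysis.FluidPDE.LerayHopf
import Literature.Analysis.FluidPDE.SuitableWeak
import Literature.Analysis.FluidPDE.SelfSimilar
import Literature.Analysis.FluidPDE.LocalTypeI
import Literature.Analysis.FluidPDE.NSWave0
import Summits.NavierStokesRegularity.NavierStokesRegularity.Theorems.TypeICertificateLadderNoBlowupToClay
import Summits.NavierStokesRegularity.NavierStokesRegularity.Theorems.RecurrentProfilesRecurrentReduction

/-!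
Route: DulacContraction

DORMANT since 2026-09-04T10:52:14Z (reconciler: no traction for 5 d (last activity statement-claimed at 2026-08-30T10:20:50Z); parked, not closed — `ledger route dormant route-NavierStokesRegularity-DulacContraction --off` to reactivate) — unstaffed, not closed; items shared with open routes are served there. `ledger route dormant <id> --off` reactivates.

# Route DulacContraction — area contraction of the Leray-rescaled flow modulo similarity reduces
Type-I blow-up to the self-similar Liouville wall

X = K1 ∧ K2 ∧ W ("it suffices to show", plus the shared Type-II half NoTypeII for Clay (A)). Card
realised:
bendixson-dulac-leray-contraction ("Dulac, not Lyapunov"), in its honest COMPACT-SET form. PHASE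
SPACE: the Albritton–Barker
local-energy Type-I class 𝒦_C on the slab ℝ³×(−∞,0) — (u,p) suitable weak (ν=1, f=0), weak gradient
G, 𝐈 = typeIBound < ∞,
rate |u| ≤ C/√(−t) — here with its smooth interior representative (classical on (−∞,0); support item
SmoothRepresentative),
acted on by the NS scaling (the Leray-rescaled flow: zooming in = log-scale σ ↓ −∞) and by the
similarity semigroup
G⁺ = {(l>0, R ∈ O(3), ξ ∈ ℝ³, τ ≤ 0)}, (g·u)(t,x) = l Rᵀ u(l²t+τ, lRx+ξ). Profiles at log-scale σ:
Π_σ w(y) = e^σ w(−e^{2σ}, e^σ y);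
weighted energy E(f) = ∫ |f(y)|² (1+|y|²)⁻² dy.
K1 SynchronizationModSimilarity (the contraction certificate, compact-set form): for every C there
are η, c, δ > 0 such that
whenever two profiles u, w ∈ 𝒦_C are δ-close at one log-scale σ₀ modulo G⁺ (E(Π_σ₀ w − Π_σ₀(g₀·u)) ≤
δ), then w SYNCHRONISES
with one fixed element of the orbit of u on every finer scale: ∃ g ∈ G⁺, E(Π_σ w − Π_σ(g·u)) ≤ c
e^{−η(σ₀−σ)} δ for all σ ≤ σ₀.
(Transversal exponential attraction modulo similarity with asymptotic phase — the integrated,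
derivative-free form of
"the linearised Leray flow contracts 2-areas modulo the symmetry bundle on 𝒦_C": the flow direction
is NOT quotiented, so
2-contraction = transversal 1-contraction, NOTES §Design 1–2.)
K2 SynchronizationForcesSelfSimilarity (the relative Pesin–Smith engine, instantiated): K1 at rate C
⇒ every profile of 𝒦_C
that is singular at the origin and uniformly recurrent under scaling (Birkhoff, L³_loc — the output
of the shared item
RecurrentReduction) is invariant, a.e. on the slab, under one similarity with dilation factor l > 1:
it is SS/RSS/DSS/RDSS.
W RDSSLiouvilleInClass (the self-similar wall, in this class): a profile of 𝒦_C invariant under a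
similarity with factor
l > 1 is regular at the space–time origin (contains Tsai's Type-I DSS conjecture and Perelman's RSS
conjecture; the named
Literature wall TypeIDSSLiouvilleConjecture implies W modulo a Chae–Wolf-type decay lemma — that
bookkeeping implication,
formerly the support item WallImpliesRDSSLiouville, was dropped at rev 5 so that no unproved
Literature constant sits in the
route's dependency cone; anyone may still prove it as a --supports lemma of W).
In words: a Type-I singularity whose tangent flows attract each other modulo similarity must be
EXACTLY self-similar modulo
similarity, and exactly self-similar Type-I profiles are the wall the literature already besieges
(NRŠ/Tsai, Chae–Wolf λ≈1,
Pineau–Vicol |α|≪1, |α|≫1). Target #0 = NoTypeIRateProfile (shared with route RecurrentProfiles,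
stmt-1588): no profile of
𝒦_C is singular at the origin; K1 → K2 → W → RecurrentReduction → SmoothRepresentative → #0 is pure
logic (TargetOfCruxes,
proved in Sketch.lean).
Lean: `SynchronizationModSimilarity ∧ SynchronizationForcesSelfSimilarity ∧ RDSSLiouvilleInClass` —
each conjunct is the one-line Prop of its block below over existing `Literature.Analysis.FluidPDE`
declarations (nsRescale, IsSuitableWeakSolutionOn, HasWeakSpatialGradientOn, typeIBound,
HasTypeITimeDecay, IsClassicalNSSolutionOn, IsBackwardSingularPoint); the opener's Sketch.lean
elaborated every item (`lean check` rc 0, 0 sorries) with `targetOfCruxes_holds`, `assembly_holds`,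
`summit_of_items` proved; DECIDING THEOREM `closes` (rev 4, gate-certified, authority native, axioms
standard): SynchronizationModSimilarity → SynchronizationForcesSelfSimilarity → RDSSLiouvilleInClass
→ RecurrentReduction → SmoothRepresentative → TypeIBlowupProfile → NoTypeII → ClayFromNoBlowup →
NavierStokesRegularity; dependency cone rev 5: 54 project constants, 0 unproved (staffable).

## Assembly
Pure logic (= the deciding theorem `closes`, rev 4; also `assembly_holds`, `summit_of_items` in the
opener's Sketch.lean): fix ν, T and a classical Leray–Hopf solution
(u,p) on [0,T) from a rapidly decaying datum; if it had no smooth extension it would be maximal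
(IsMaximalSmoothSolution :=
classical ∧ ¬HasSmoothExtensionPast), NoTypeII gives the Type-I rate, TypeIBlowupProfile a profile
of 𝒦_C singular at the
origin, RecurrentReduction a uniformly recurrent singular one, SmoothRepresentative its smooth
representative (still singular,
still recurrent), SynchronizationForcesSelfSimilarity (fed with SynchronizationModSimilarity at that
C) makes it invariant
under a similarity with factor l>1, and RDSSLiouvilleInClass declares it regular at the origin —
contradiction; hence NoBlowup,
and ClayFromNoBlowup gives NavierStokesRegularity.

Rationale: WHY THIS LINE. Mechanism (card bendixson-dulac-leray-contraction): replace the barred search for a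
Lyapunov functional by a CONTRACTION
certificate for the Leray-rescaled flow on the compact Type-I tangent-flow space 𝒦_C —
Li–Muldowney/Leonov/Smith's
higher-dimensional Bendixson–Dulac theory (Muldowney1990, LiMuldowney1993, LiMuldowney1996,
LiMuldowney2000, Smith1986,
KuznetsovReitmann2021; control-theoretic form WuKanevskiyMargaliot2020) transplanted to a parabolic
semiflow modulo the
blow-up similarity group, with Pesin theory for Hilbert/Banach-space semiflows (LianYoung2012,
Ma2022) as the bridge from
linear contraction to dynamics. Dictionary: ODE ẋ=f(x) ↦ profile equation ∂_sU = ΔU − ½U − ½y·∇U −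
P(U·∇U); compact
absorbing set ↦ 𝒦_C (AlbrittonBarker2019 Lemma 2.2 / Lin1998, PROVED in tree:
SuitableCompactness_holds,
PersistenceOfSingularities_holds); periodic orbit ↦ λ-DSS profile, relative periodic orbit ↦ RDSS,
relative equilibrium ↦
SS/RSS; first integrals / invariant manifold of LiMuldowney2000 ↦ the 7 similarity modes (exponents
1, ½,½,½, 0,0,0).
What the line adds to the ledger: route RecurrentProfiles reduces Type-I exclusion to UNIFORMLY
RECURRENT profiles by
Birkhoff; this route supplies an engine that collapses recurrence to EXACT self-similarity modulo
similarity (K1 ⇒ K2), so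
that the whole recurrent zoo (quasi-periodic tori, weakly mixing minimal sets) is reduced to the
single named wall
TypeIDSSLiouvilleConjecture (Tsai2018 Conj. 8.8–8.9, BradshawTsai2017CPDE OP 5.1–5.2,
ChaeWolf2017RemovingDSS Thm 1.3,
PineauVicol2026 Thm 1.4 / Conj. 1.1). Honest correction of the card recorded in the items:
contraction hypotheses ON 𝒦_C
make a DSS orbit orbitally STABLE (Muldowney1990, orbital-stability theorem via the second compound)
rather than absent —
Bendixson's exclusion needs the criterion on a simply connected region spanning the orbit, where the
profile semiflow is
not defined — so the wall is a crux here, not a corollary.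

RANKED CRUXES. #0 NoTypeIRateProfile (target) — NO TYPE-I SINGULARITY MODEL in the local-energy
class (verbatim the target of route RecurrentProfiles, stmt-NavierStokesRegularity-1588): every
suitable weak solution (u,p) of NS (ν=1,f=0) on ℝ³×(−∞,0) with weak gradient G, typeIBound < ∞ and
rate |u| ≤ C/√(−t) is regular at the space–time origin. Reached from K1, K2, W by RecurrentReduction
+ SmoothRepresentative (glue TargetOfCruxes, pure logic, proved in Sketch.lean). (why it might fail:
A Type-I profile may exist: Tsai's Type-I DSS conjecture is open beyond λ≈1 (ChaeWolf2017RemovingDSS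
Thm 1.3) and RSS is open for α≈1 (PineauVicol2026); Hou's nearly self-similar numerics aim at such
an object.) [AlbrittonBarker2019, KNSS2009, ChaeWolf2017RemovingDSS, PineauVicol2026,
Hou2022PotentiallySingularNS]
#2 SynchronizationModSimilarity (crux) — [card K1, compact-set form] SYNCHRONISATION MODULO
SIMILARITY IN THE TYPE-I CLASS. For every rate C there are η>0, c≥0, δ>0 such that for all smooth
profiles (u,p,G), (w,q,H) of 𝒦_C (suitable weak on the slab, weak gradient, typeIBound<∞,
HasTypeITimeDecay C, classical on (−∞,0)), every log-scale σ₀ and every comparison element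
g₀=(l₀>0,R₀,ξ₀,τ₀≤0): if E(Π_σ₀ w − Π_σ₀(g₀·u)) ≤ δ (E(f)=∫|f|²(1+|y|²)⁻²dy, Π_σ w(y)=e^σ
w(−e^{2σ},e^σ y), (g·u)(t,x)=l Rᵀu(l²t+τ,lRx+ξ)) then there is ONE g=(l>0,R,ξ,τ≤0) with E(Π_σ w −
Π_σ(g·u)) ≤ c e^{−η(σ₀−σ)} δ for every σ ≤ σ₀. Equivalent reading: every Type-I tangent flow is
uniformly exponentially attracting transversally to the similarity directions, with asymptotic phase
(the flow/scaling direction is absorbed in g, not quotiented). At u=0 it is one-slice weighted-L²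
ε-regularity for Type-I-bounded local-energy solutions (JiaSverak2014, BarkerPrange2020); the
intended certificate is a matrix Dulac function: a Lozinskii bound μ(ȦA⁻¹ + A·L_U^{[2]}·A⁻¹) ≤ −η
for the second additive compound of the linearised profile operator modulo the 7 similarity modes
(Muldowney1990, LiMuldowney1996, KuznetsovReitmann2021 Ch. 5), integrated along 𝒦_C (two-layer
plan). [difficulty: XL] (why it might fail: Asserts EVERY Type-I tangent flow attracts transversally
mod similarity at a uniform rate: a saddle-type DSS profile, an invariant 2-torus or a chaotic
tangent flow refutes it; at large C, L_U has numerical range up to ‖∇U‖∞−½>0 and no coercive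
transversal identity is known.) [Muldowney1990, LiMuldowney1996, LiMuldowney2000,
KuznetsovReitmann2021, ChaeWolf2017RemovingDSS, PineauVicol2026, BarkerPrange2020, JiaSverak2014,
AlbrittonBarker2019]
#3 SynchronizationForcesSelfSimilarity (crux) — [card K2, instantiated to NS; the relative
Pesin–Smith engine] K1 at the same rate C (inlined as the let-bound hypothesis `SyncModSim C`) ⇒
every smooth profile (w,q,H) of 𝒦_C that is SINGULAR at the origin and UNIFORMLY RECURRENT under
scaling in L³_loc (Birkhoff: ∀ε ∀K compact ⊆ {t≤0} ∃L ∀a ∃σ∈[a,a+L]: ‖w_σ − w‖_{L³(K)} ≤ ε, verbatim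
the recurrence of route RecurrentProfiles) is invariant, a.e. on the slab, under one similarity with
dilation factor l>1: ∃ l>1, R, ξ, τ≤0 with l Rᵀw(l²t+τ, lRx+ξ) = w(t,x) a.e. — i.e. w is
SS/RSS/DSS/RDSS about a centre (x*, t*≥0) (t*=0 forced for singular w). Proof intended: recurrence
gives zoom-outs w_{s_n}→w; K1 synchronises w_{s_n} with g_n·w, hence w ≈ h_n·w with h_n =
scale(e^{−s_n})∘g_n and error ≤ c e^{−ηs_n/2}δ uniformly on all scales ≤ s_n/2; translation
components of h_n are excluded by ε-regularity (a translate of a Type-I profile is regular at the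
origin, quantitatively), and the approximate self-similarities are upgraded to one exact factor by
compactness of 𝒦_C (AlbrittonBarker2019 Lemma 2.2, PROVED in tree) — the asymptotic-phase/Pesin
argument of LiMuldowney1995 (Smith's autonomous convergence theorem) and LianYoung2012/Ma2022
without a closing lemma. [deps: SynchronizationModSimilarity] [difficulty: L] (why it might fail:
The approximate self-similarities h_n have dilation factors → ∞; extracting ONE exact factor needs
uniform-in-scale control plus exclusion of translation components by quantitative ε-regularity — an
asymptotic-phase/Pesin argument on a compact L³_loc class nobody has written in infinite
dimensions.) [LiMuldowney1995, LianYoung2012, Ma2022, BarreiraPesin2023, Smith1986,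
AlbrittonBarker2019, Furstenberg1981, BarkerPrange2020]
#4 RDSSLiouvilleInClass (crux) — [the self-similar wall in the A–B class] A smooth profile (w,q,H)
of 𝒦_C (rate C) that is invariant a.e. on the slab under a similarity with dilation factor l>1 (∃
l>1, R∈O(3), ξ, τ≤0: l Rᵀw(l²t+τ,lRx+ξ) = w(t,x) a.e.; centre (x*,t*), t* = −τ/(l²−1) ≥ 0) is
REGULAR at the space–time origin. Cases: t*>0 — trivial (w bounded near t=0); t*=0, x*≠0 —
regularity off the centre of a Type-I (R)DSS solution (ChaeWolf2017RemovingDSS Thm 1.1 for DSS in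
L^p; to be redone in the local-energy class); t*=0, x*=0 — Tsai's Type-I λ-DSS conjecture for every
λ>1 (Tsai2018 Conj. 8.8, BradshawTsai2017CPDE OP 5.1; known for 1<λ<λ_*(C): ChaeWolf2017RemovingDSS
Thm 1.3; SS: NecasRuzickaSverak1996, Tsai1998) and Perelman's RSS/RDSS conjecture for every rotation
(Tsai2018 Conj. 8.9; known for |α|≪1 and |α|≫1: PineauVicol2026 Thm 1.4). Implied by the named
Literature wall TypeIDSSLiouvilleConjecture modulo a decay lemma (former support item
WallImpliesRDSSLiouville, dropped at rev 5 for cone hygiene; provable by anyone as a --supports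
lemma). [difficulty: open-problem] (why it might fail: Contains Tsai's Type-I DSS conjecture for
every λ>1 (only λ≈1 known, ChaeWolf2017RemovingDSS Thm 1.3) and Perelman's RSS conjecture at α≈1
(PineauVicol2026 leaves it open: no head-pressure maximum principle); one nontrivial Type-I RDSS
profile (route Blowup's stmt-0155) refutes it.) [ChaeWolf2017RemovingDSS, PineauVicol2026,
BradshawTsai2017CPDE, Tsai2018, NecasRuzickaSverak1996, Tsai1998]
#5 NoTypeII (crux) — [shared with routes TypeILiouville / RecurrentProfiles,
stmt-NavierStokesRegularity-0056, verbatim] a maximal finite-energy classical solution from a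
rapidly decaying datum with finite lifespan blows up at the Type-I rate. The card is the Type-I half
only and says so. [difficulty: open-problem] (why it might fail: No theorem bounds a blow-up rate
from above; Tao's averaged-NS blow-up is Type II (arXiv:1402.0290 p.8 fn.), so abstract methods
cannot prove it; KNSS2009 p.4: every axisymmetric singularity is Type II, so Hou's candidate, if
real, refutes it.) [Tao2016AveragedNS, KNSS2009, Hou2022PotentiallySingularNS, Seregin2012,
EscauriazaSereginSverak2003]
#9 RecurrentReduction (support) — [shared with route RecurrentProfiles,
stmt-NavierStokesRegularity-1590, verbatim; soft, provable now from PROVED tree facts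
SuitableCompactness_holds + PersistenceOfSingularities_holds] if a profile of 𝒦_C (rate C) is
singular at the origin then some profile of 𝒦_C with the same C is singular at the origin AND
uniformly recurrent under scaling in L³_loc (a minimal set of the scaling flow in the compact
invariant set of origin-singular profiles: Zorn + Birkhoff). [difficulty: M] [AlbrittonBarker2019,
Lin1998, Furstenberg1981, GigaKohn1985]
#9 SmoothRepresentative (support) — [glue between the a.e. class and its smooth interior
representative] a profile (u,p,G) of 𝒦_C (rate C) admits (u',p',G') in 𝒦_C with the same C,
classical on (−∞,0) (interior regularity of locally bounded suitable weak solutions; the pressure is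
re-normalised to the Riesz-transform pressure, the parasitic harmonic part being killed by
typeIBound<∞), u' = u a.e. on the slab, and the transfers (origin singular for u ⇒ for u') and
(uniformly recurrent u ⇒ u') (both notions are invariant under a.e. modification; stated as
implications to keep the glue pure logic). [difficulty: M] [Serrin1962, KNSS2009, CKN1982, Lin1998,
Literature.Analysis.FluidPDE.KNSS2009_regularity_boundedWeak_ancient]
#9 WallImpliesRDSSLiouville (support; DROPPED at rev 5 — cone hygiene: it was the only decl of the
route reaching the unproved Literature constant TypeIDSSLiouvilleConjecture (undeclared-conjecture ⇒
unstaffable); not used by `closes`; kept here for the record, provable as a --supports lemma of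
RDSSLiouvilleInClass) — [bookkeeping + one lemma] the named wall
Literature.Analysis.FluidPDE.TypeIDSSLiouvilleConjecture (all factors λ>1, all R∈O(3); class:
ancient mild, measurable slices, IsRotatedDSS about the origin, space–time decay |u| ≤
C₀/(|x|+√(−t))) implies RDSSLiouvilleInClass: translate the centre x* to the origin (the class is
translation invariant), dispose of t*>0 by boundedness, pass from the a.e. identity to the pointwise
one for the smooth representative, show suitable-weak + bounded ⇒ ancient mild, and derive the SPACE
decay of a Type-I-rate (R)DSS profile in the local-energy class from regularity off the centre
(ChaeWolf2017RemovingDSS Thm 1.1-type lemma, here with typeIBound<∞ instead of L^p slices).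
[difficulty: M] [ChaeWolf2017RemovingDSS, BradshawTsai2017CPDE, AlbrittonBarker2019, KNSS2009]
#9 TypeIBlowupProfile (support) — [shared with route RecurrentProfiles,
stmt-NavierStokesRegularity-1591, verbatim] a Type-I-rate blow-up of a maximal finite-energy
classical solution from a rapidly decaying datum generates a profile of 𝒦_C singular at the origin
(ν-normalisation, singular point at T_max, AlbrittonBarker2019 Lemma 2.5 weak-Serrin ⇒ 𝐈<∞, zoom-in
with SuitableCompactness/Persistence). [difficulty: M] [AlbrittonBarker2019, KNSS2009,
SereginSverak2009, Seregin2012, Lin1998]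
#9 ClayFromNoBlowup (support) — [shared with routes TypeILiouville / RecurrentProfiles,
stmt-NavierStokesRegularity-0055, verbatim] NoBlowup ⇒ Clay (A): local classical theory,
continuation, weak–strong uniqueness, energy inequality, isNavierStokesSolution_and_smooth_iff.
[difficulty: M] [KNSS2009, AlbrittonBarker2019, Leray1934, Fefferman2000]
#9 TargetOfCruxes (support) — [glue, pure logic, PROVED in Sketch.lean as targetOfCruxes_holds]
SynchronizationModSimilarity → SynchronizationForcesSelfSimilarity → RDSSLiouvilleInClass →
RecurrentReduction → SmoothRepresentative → NoTypeIRateProfile (by decl name, the template form; the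
decls precede it in the route file): a singular class profile yields a recurrent singular one, then
a smooth recurrent singular one, which K2(K1) makes RDSS and W makes regular — contradiction.
[difficulty: provable-now] [AlbrittonBarker2019, Furstenberg1981]

TWO-LAYER PLAN. Foreseen glued splits (k ≤ 3, depth 1; nothing filed now):
SynchronizationModSimilarity ⇐ LinearAreaContraction → LinearToNonlinearSync →
SynchronizationModSimilarity — LinearAreaContraction
is the card's certificate proper: a field of coercive quadratic forms A(U) on the linearised tangent
space modulo the 7
similarity modes with Lozinskii measure μ(ȦA⁻¹ + A·L_U^{[2]}·A⁻¹) ≤ −η on 𝒦_C (equivalently, since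
the scaling direction is
neutral and not quotiented, uniform contraction of the linearised scaling cocycle transversally to
similarity ⊕ scaling);
LinearToNonlinearSync is Lyapunov–Perron/Pesin for the profile semiflow realised as a C^{1+α},
compact, injective (backward
uniqueness, EscauriazaSereginSverak2003) local semiflow in a weighted space (LianYoung2012, Ma2022).
Needs the definition
request below (second additive compound / Lozinskii measure) — filed as an informal support item
after open.
SynchronizationForcesSelfSimilarity ⇐ ApproximateToExactFactor → TranslationExclusion →
SynchronizationForcesSelfSimilarity
(compactness upgrade of approximate self-similarities at dilations → ∞ to one exact factor;
quantitative ε-regularity kills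
translation components).
RDSSLiouvilleInClass ⇐ DSSAllFactors (Tsai, every λ>1) → RSSAllRates (Perelman/Pineau–Vicol, every
α, and RDSS) →
OffCentreRegularity (Chae–Wolf Thm 1.1 in the local-energy class) → RDSSLiouvilleInClass.

KILL CRITERIA. - A nontrivial Type-I (R)DSS or RSS profile — ¬TypeIDSSLiouvilleConjecture, route
Blowup's stmt-NavierStokesRegularity-0155, or
  a witness from cards large-constant-euler-melnikov / quarter-turn-rdss-funnel /
corkscrew-dynamo-bootstrap-dss / dss-far-field-slaving —
  refutes RDSSLiouvilleInClass: close `refuted:RDSSLiouvilleInClass` (K1, K2 survive as a structure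
theorem "Type-I blow-up is
  exactly self-similar modulo similarity", handed to the negative side).
- SynchronizationModSimilarity refuted ⇒ two non-synchronising Type-I(C) profiles exist ⇒ 𝒦_C ≠ {0}
⇒ Type-I blow-up exists
  (AlbrittonBarker2019 Thm 1.1): close refuted and hand the pair to the Blowup routes; if only its
u=0 rung (one-slice weighted
  ε-regularity) fails, RESTATE with closeness measured on a unit log-scale window instead of one
slice (repair, not a kill).
- SynchronizationForcesSelfSimilarity refuted needs K1 true AND a recurrent singular
non-self-similar profile: pivot = repair the
  engine's hypotheses (abstract counterexample analysis), not a close.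
- NoTypeII refuted (a Schwartz-data Type-II blow-up) = ¬Clay (A): shared fate with
TypeILiouville/RecurrentProfiles.
- Mooted/superseded: NoBlowup (stmt-0054), (L) (stmt-0057) or RecurrentLiouville (stmt-1589) proved
⇒ `superseded --by` that route;
  NoTypeIRateProfile proved elsewhere closes #0 for us too.

NOT DECOMPOSED YET. The Dulac metric A(U) and the weighted space carrying the linearisation (layer-2
child of K1); backward uniqueness /
injectivity and C^{1+α}-smoothness of the profile semiflow on 𝒦_C (inside LinearToNonlinearSync);
the abstract relative
Pesin–Smith theorem (filed informal, Literature-grade, after open); the three regimes of the wall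
(children of
RDSSLiouvilleInClass); the ν-normalisation and Lemma 2.5 inside TypeIBlowupProfile; anything Type
II. Deliberately NOT
filed: the Bendixson REGION upgrade (2-contraction on discs spanning a DSS loop, Muldowney1990 Thm 1
/ LiMuldowney1993) that
would discharge the wall — the profile semiflow is not globally defined on a simply connected region
around 𝒦_C
(perturbations blow up earlier), and on 𝒦_C alone contraction yields orbital stability of a DSS
orbit (Muldowney1990), not
its absence; recorded so that nobody re-files the card's original K2.

CHEAPEST FALSIFIER. (1) Engine shape behind K2, pen and paper (this session: limit cycle consistent;
2-torus excluded because the scaling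
direction is NOT quotiented; saddle + heteroclinic excluded by uniformity; odometer/Denjoy excluded
by exponential sync): break "uniform transversal synchronisation mod a compact group on a compact
invariant set with
entire orbits ⇒ every point relatively periodic" by a smooth flow on a compact manifold — a
counterexample forces a restatement
of K2. (2) The card's kit job: top transverse exponent of the linearised profile operator modulo
similarity modes at the large
forward self-similar profiles (JiaSverak2014; Guillod–Šverák arXiv:1704.00560; opposite drift sign)
in the weight (1+|y|²)⁻²:
positivity at moderate amplitude means transversal contraction is not structural, so K1 can hold
only vacuously and its
certificate child is hopeless beyond small C. (3) Lookup for the u=0 rung of K1: does local-in-space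
smoothing (BarkerPrange2020
Thm 1, JiaSverak2014 Thm 3.1) reach the final time for a Type-I-bounded local-energy solution with
profile small in
L²((1+|y|²)⁻²) on a C-dependent ball? If not even with δ=δ(C), restate K1 with window closeness.

NUMBERS. Spectrum of 𝓛 = Δ − ½y·∇ − ½ on L²_σ(e^{−|y|²/4}): −½ − k/2, k ≥ 0 (top: constants, −½);
similarity modes at a profile:
exponents 1 (time shift, U + y·∇U-type), ½ ×3 (space shifts), 0 ×3 (rotations), 0 (scaling = flow
direction); hence
un-quotiented λ₁+λ₂ ≥ 1 at every nontrivial profile — the quotient is forced. Weight exponent m = 4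
in (1+|y|²)^{−m/2}:
window 3 < m ≤ 5 (m > 3: finite on bounded profiles; m ≤ 5: far-field pressure-gradient influence
O(Λ⁻¹) stays below its
weighted visibility Λ^{(3−m)/2}, so the statement is not morally false the way a Gaussian weight
would make it). Known rungs of
the wall: SS (NecasRuzickaSverak1996 Thm 1, Tsai1998 Thms 1–2), λ ∈ (1, λ_*(C))
(ChaeWolf2017RemovingDSS Thm 1.3), RSS with
|α| < α_(C) or |α| > ᾱ(C) (PineauVicol2026 Thm 1.4), axisymmetric (SereginSverak2009); open: λ ≥
λ_*(C), α ≈ 1, RDSS.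
Finite-dimensional calibration: Muldowney1990 (2-compound contraction along a periodic orbit ⇒
orbital asymptotic stability);
LiMuldowney1995 (autonomous convergence needs the condition on the region + C¹ closing lemma). Items
at open: 12 (target, 4
cruxes, 6 support, assembly); shared verbatim with RecurrentProfiles/TypeILiouville: 1588, 1590,
1591, 0055, 0056. Rev 5 (route-repair):
11 Lean items + 1 informal (WallImpliesRDSSLiouville dropped), import SelfSimilarLiouville dropped,
deciding theorem `closes`
certified (rev 4), dependency cone 54 constants / 0 unproved ⇒ staffable. Tree facts
behind RecurrentReduction/TypeIBlowupProfile: SuitableCompactness_holds,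
PersistenceOfSingularities_holds (2/2 proved); the glue itself uses none. Negatives index: 0 refuted
statements (2026-08-15).

DEFINITION REQUESTS. - SecondAdditiveCompound / LozinskiiMeasure (topic Literature/Dynamics): the
second additive compound A^{[2]} of a closed,
  densely defined operator A on a Hilbert space H acting on Λ²H (generator of t ↦ (e^{tA})^{∧2}),
and the logarithmic norm
  μ_Q(B) = sup Re⟨Bx,x⟩_Q/⟨x,x⟩_Q for a coercive quadratic form Q, with the state-dependent (Leonov
varying-metric) version
  μ(Q̇Q⁻¹ + Q A^{[2]} Q⁻¹); Mathlib has ExteriorAlgebra/exterior powers of modules but no compound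
of an unbounded operator
  and no Lozinskii measure. Wanted for the layer-2 child LinearAreaContraction of
SynchronizationModSimilarity and for the
  informal abstract engine item; filed with `ledger workitem add --kind definition` after open.
- No definition is needed by the 12 filed items (profiles, weighted energy and the similarity action
are inlined `let`s over
  nsRescale).

Novelty: Searches (2026-08-15, this session; searchd flaky rc 75, OpenAlex/S2/arXiv rate-limited, crossref +
local OK): `lit search "Li
Muldowney Bendixson criterion compound matrices global stability autonomous convergence theorem"`
(local 6 held hits incl.
arXiv:2008.10321 and doi:10.1006/jdeq.2000.3888, both READ: p.12 Thms 1–3 of the survey =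
Muldowney1990/LiMuldowney1995;
LiMuldowney2000 Thms 4.1, 4.2, 6.1; crossref 15 rows: doi:10.1006/jdeq.1993.1097,
doi:10.1216/rmjm/1181072289,
doi:10.1216/rmjm/1181073047, doi:10.1137/s0036141094266449, McCluskey–Muldowney SIAM Rev. 1998);
`lit search --source crossref
"Lian Young Lyapunov exponents periodic orbits horseshoes semiflows Hilbert spaces"` (10 rows:
doi:10.1090/s0894-0347-2012-00734-6,
doi:10.1007/s00023-011-0100-9, Ma 2022 doi:10.1007/s00526-022-02330-4); `lit search --source
crossref "Kuznetsov Reitmann attractor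
dimension estimates"` (doi:10.1007/978-3-030-50987-3); `lit read arxiv:2607.09619 --pages 1-6`
(PineauVicol2026 Conj. 1.1, Thm 1.4,
p.4 "no scalar quantity with a maximum principle"); `lit galaxy search --star all` ×3 ("semiflows on
Hilbert space", "Lyapunov
exponents for semiflows on Hilbert spaces", full Lian–Young title: 0 relevant); `lit frontier
NavierStokesRegularity --since 2022`
(30 rows: forward self-similar / non-uniqueness / Hou FoCM 2026 — no dynamical-systems criterion on
NS profiles); `lit bridges
NavierStokesRegularity --cross any` (30 rows, surveys only); ledger: 45 routed + 22 open + 55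
retired NS cards  [refs: 10.1006/jdeq.2000.3888, 10.1006/jdeq.1993.1097, 10.1216/rmjm/1181072289, 10.1216/rmjm/1181073047, 10.1137/s0036141094266449, 10.1090/s0894-0347-2012-00734-6, 10.1007/s00023-011-0100-9, 10.1007/s00526-022-02330-4, 10.1007/978-3-030-50987-3, 2008.10321, 2607.09619, doi:10.1006/jdeq.2000.3888, doi:10.1006/jdeq.1993.1097, doi:10.1216/rmjm/1181072289, doi:10.1216/rmjm/1181073047, doi:10.1137/s003614109]

Barriers (technique_class: contraction-metric second-compound liouville-rigidity): - technique_class: contraction-metric second-compound liouville-rigidity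
- Literature.Barriers.NavierStokesRegularity.TaoAveragedBlowup: K1/K2 are soft structure statements
that would transfer to an averaged bilinear form with the same symmetries — and that is CONSISTENT,
because Tao's averaged blow-up is Type II (arXiv:1402.0290 p.8 fn.) and an exactly-DSS Type-I
witness of a toy model is an attracting relative periodic orbit, allowed by K1; the barrier lands
entirely on RDSSLiouvilleInClass (needs the head-pressure / vorticity structure of the true B:
NecasRuzickaSverak1996, PineauVicol2026) and on NoTypeII (backward uniqueness
EscauriazaSereginSverak2003) — it does not; the bet is that those two NS-specific items carry all
the fine structure.
- Literature.Barriers.NavierStokesRegularity.TruncatedDyadicBlowup: the truncated dyadic Type-I DSS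
witness is a periodic orbit in shell-similarity variables; K1 on the compact set predicts it is
orbitally STABLE, which is what the model shows — no conflict; again the wall item is where the true
equation must differ.
- Literature.Barriers.NavierStokesRegularity.EnergySupercriticality: evaded by K1/K2
(scale-invariant class 𝒦_C, the energy is never used coercively; closeness is measured in a
scale-covariant weighted norm of profiles); NOT evaded by NoTypeII (same bet as TypeILiouville);
RDSSLiouvilleInClass sits exactly at the borderline decay |U| ≲ (1+|y|)⁻¹ ∉ L³ (PineauVicol2026 p.4)
— the bet is rigidity of exact self-similarity, no

History (route lifecycle, newest last):
- 2026-08-15T16:16:55Z · rev 5: dropped WallImpliesRDSSLiouville — route-repair (cone): needs-fact: none. (1) drop support item WallImpliesRDSSLiouville (stmt-NavierStokesRegularity-8563) — not load-bearing: the deciding theore (planner-rbadge-NavierStokesRegularity-DulacCon-3a964d25-g4-0)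
- 2026-09-04T10:52:14Z · DORMANT — reconciler: no traction for 5 d (last activity statement-claimed at 2026-08-30T10:20:50Z); parked, not closed — `ledger route dormant route-NavierStokesRegulari (operator:999:3912032)

sub-problem: NavierStokesRegularity · status: dormant · opened planner-plancard-NavierStokesRegularity-Navie-bb42b983-0 2026-08-15T13:13:06Z · rev 6 · ledger route-NavierStokesRegularity-DulacContraction
GENERATED by the gate from the ledger (D-0016/17). Provers cite these decls: `theorem foo : Summit.NavierStokesRegularity.NavierStokesRegularity.Theses.DulacContraction.<Decl> := …` in Summits/NavierStokesRegularity/NavierStokesRegularity/Theorems/<Name>.lean.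
-/

namespace Summit.NavierStokesRegularity.NavierStokesRegularity.Theses.DulacContraction

open scoped BigOperators Topology Manifold Classical MeasureTheory ProbabilityTheory Matrix InnerProductSpace ComplexConjugate ContinuousMap
open Filter Set Function TopologicalSpace MeasureTheory

attribute [summit_statement] _root_.NavierStokesRegularity

open Literature.NS

/-- item stmt-NavierStokesRegularity-1588 · target · rank 0 · open · by planner
why it might fail: A nontrivial Type-I singular profile may exist (⇔ Type-I blow-up, arXiv:1811.00502 Thm 1.1): Liouville is known only for SS (NRŠ1996, Tsai1998), λ-DSS with 1<λ<λ_*(C) and RSS/RDSS at extreme α under space–time decay (arXiv:1610.09464 Thm 1.3; arXiv:2607.09619 Thms 1.4–1.7); large λ, α≈1: open.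
sources: AlbrittonBarker2019, arXiv:1811.00502, ChaeWolf2017RemovingDSS, PineauVicol2026, NecasRuzickaSverak1996, Tsai1998
[target] NO TYPE-I SINGULARITY MODEL in the local-energy class: every suitable weak solution (u,p)
of NS (ν=1, f=0) on the slab ℝ³×(−∞,0) with weak gradient G, Albritton–Barker quantity 𝐈(ℝ³×ℝ₋) =
typeIBound < ∞ and the Type-I rate |u(x,t)| ≤ C/√(−t) is REGULAR at the space–time origin
(essentially bounded on some backward parabolic ball Q((0,0),r)). Follows from RecurrentReduction +
RecurrentLiouville by two lines of logic (Sketch.lean `target_of_cruxes`); with TypeIBlowupProfile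
it excludes Type-I-rate blow-up of finite-energy classical solutions from rapidly decaying data —
the Type-I half of route TypeILiouville, over the A–B class (which pins the drift) instead of KNSS
(L). Card: recurrent-type-i-profiles. -/
@[route_item "route-NavierStokesRegularity-DulacContraction"]
def NoTypeIRateProfile : Prop :=
  ∀ (u : ℝ → EuclideanSpace ℝ (Fin 3) → EuclideanSpace ℝ (Fin 3)) (p : ℝ → EuclideanSpace ℝ (Fin 3) → ℝ) (G : ℝ → EuclideanSpace ℝ (Fin 3) → EuclideanSpace ℝ (Fin 3) →L[ℝ] EuclideanSpace ℝ (Fin 3)) (C : ℝ), Literature.Analysis.FluidPDE.IsSuitableWeakSolutionOn (Literature.Analysis.FluidPDE.slab (EuclideanSpace ℝ (Fin 3)) (Set.Iio 0) isOpen_Iio) 1 0 u p → Literature.Analysis.FluidPDE.HasWeakSpatialGradientOn (Literature.Analysis.FluidPDE.slab (EuclideanSpace ℝ (Fin 3)) (Set.Iio 0) isOpen_Iio) u G → Literature.Analysis.FluidPDE.typeIBound (Set.Iio (0 : ℝ) ×ˢ Set.univ) u p G < ⊤ → Literature.Analysis.FluidPDE.HasTypeITimeDecay C u → ¬ Literature.Analysis.FluidPDE.IsBackwardSingularPoint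 u 0

/-- item stmt-NavierStokesRegularity-8559 · crux · rank 2 · open · by planner
why it might fail: One (η,c,δ) per rate C must serve all finite 𝐈, but C does not bound 𝐈 (arXiv:1811.00502 Rem 3.2) and smoothing constants live on {𝐈≤M} (BarkerPrange2020 Thm 2); if 𝒦_C≠{0} EVERY Type-I tangent flow must attract mod similarity: one saddle (R)DSS profile (heat analogue arXiv:1605.07337) refutes it.
sources: arXiv:1811.00502, BarkerPrange2020, arXiv:1605.07337, Muldowney1990, LiMuldowney1996, JiaSverak2014
[crux] [card K1, compact-set form] SYNCHRONISATION MODULO SIMILARITY IN THE TYPE-I CLASS. For every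
rate C there are η>0, c≥0, δ>0 such that for all smooth profiles (u,p,G), (w,q,H) of 𝒦_C (suitable
weak on the slab, weak gradient, typeIBound<∞, HasTypeITimeDecay C, classical on (−∞,0)), every
log-scale σ₀ and every comparison element g₀=(l₀>0,R₀,ξ₀,τ₀≤0): if E(Π_σ₀ w − Π_σ₀(g₀·u)) ≤ δ
(E(f)=∫|f|²(1+|y|²)⁻²dy, Π_σ w(y)=e^σ w(−e^{2σ},e^σ y), (g·u)(t,x)=l Rᵀu(l²t+τ,lRx+ξ)) then there is
ONE g=(l>0,R,ξ,τ≤0) with E(Π_σ w − Π_σ(g·u)) ≤ c e^{−η(σ₀−σ)} δ for every σ ≤ σ₀. Equivalent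
reading: every Type-I tangent flow is uniformly exponentially attracting transversally to the
similarity directions, with asymptotic phase (the flow/scaling direction is absorbed in g, not
quotiented). At u=0 it is one-slice weighted-L² ε-regularity for Type-I-bounded local-energy
solutions (JiaSverak2014, BarkerPrange2020); the intended certificate is a matrix Dulac function: a
Lozinskii bound μ(ȦA⁻¹ + A·L_U^{[2]}·A⁻¹) ≤ −η for the second additive compound of the linearised
profile operator modulo the 7 similarity modes (Muldowney1990, LiMuldowney1996,
KuznetsovReitmann2021 Ch. 5), integrated along 𝒦_C (two-l -/
@[route_item "route-NavierStokesRegularity-DulacContraction"]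
def SynchronizationModSimilarity : Prop :=
  let prof := fun (σ : ℝ) (w : ℝ → EuclideanSpace ℝ (Fin 3) → EuclideanSpace ℝ (Fin 3)) (y : EuclideanSpace ℝ (Fin 3)) => Literature.Analysis.FluidPDE.nsRescale (Real.exp σ) w (-1) y; let Ew := fun (f : EuclideanSpace ℝ (Fin 3) → EuclideanSpace ℝ (Fin 3)) => ∫⁻ y, ‖f y‖ₑ ^ 2 * ENNReal.ofReal ((1 + ‖y‖ ^ 2)⁻¹ ^ 2); let act := fun (l : ℝ) (R : EuclideanSpace ℝ (Fin 3) ≃ₗᵢ[ℝ] EuclideanSpace ℝ (Fin 3)) (ξ : EuclideanSpace ℝ (Fin 3)) (τ : ℝ) (w : ℝ → EuclideanSpace ℝ (Fin 3) → EuclideanSpace ℝ (Fin 3)) (t : ℝ) (x : EuclideanSpace ℝ (Fin 3)) => l • R.symm (w (l ^ 2 * t + τ) (l • R x + ξ)); ∀ C : ℝ, (∃ η c δ : ℝ, 0 < η ∧ 0 ≤ c ∧ 0 < δ ∧ ∀ (u : ℝ → EuclideanSpace ℝ (Fin 3) → EuclideanSpace ℝ (Fin 3)) (p : ℝ → EuclideanSpace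 ℝ (Fin 3) → ℝ) (G : ℝ → EuclideanSpace ℝ (Fin 3) → EuclideanSpace ℝ (Fin 3) →L[ℝ] EuclideanSpace ℝ (Fin 3)), Literature.Analysis.FluidPDE.IsSuitableWeakSolutionOn (Literature.Analysis.FluidPDE.slab (EuclideanSpace ℝ (Fin 3)) (Set.Iio 0) isOpen_Iio) 1 0 u p → Literature.Analysis.FluidPDE.HasWeakSpatialGradientOn (Literature.Analysis.FluidPDE.slab (EuclideanSpace ℝ (Fin 3)) (Set.Iio 0) isOpen_Iio) u G → Literature.Analysis.FluidPDE.typeIBound (Set.Iio (0 : ℝ) ×ˢ Set.univ) u p G < ⊤ → Literature.Analysis.FluidPDE.HasTypeITimeDecay C u → Literature.Analysis.FluidPDE.IsClassicalNSSolutionOn (Set.Iio 0) 1 0 u p → ∀ (w : ℝ → EuclideanSpace ℝ (Fin 3) → EuclideanSpace ℝ (Fin 3)) (q : ℝ → EuclideanSpace ℝ (Fin 3) → ℝ) (H : ℝ → EuclideanSpace ℝ (Fin 3) → EuclideanSpace ℝ (Fin 3) →L[ℝ] EuclideanSpace ℝ (Fin 3)), Literature.Analysis.FluidPDE.IsSuitableWeakSolutionOn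 (Literature.Analysis.FluidPDE.slab (EuclideanSpace ℝ (Fin 3)) (Set.Iio 0) isOpen_Iio) 1 0 w q → Literature.Analysis.FluidPDE.HasWeakSpatialGradientOn (Literature.Analysis.FluidPDE.slab (EuclideanSpace ℝ (Fin 3)) (Set.Iio 0) isOpen_Iio) w H → Literature.Analysis.FluidPDE.typeIBound (Set.Iio (0 : ℝ) ×ˢ Set.univ) w q H < ⊤ → Literature.Analysis.FluidPDE.HasTypeITimeDecay C w → Literature.Analysis.FluidPDE.IsClassicalNSSolutionOn (Set.Iio 0) 1 0 w q → ∀ (σ₀ l₀ : ℝ) (R₀ : EuclideanSpace ℝ (Fin 3) ≃ₗᵢ[ℝ] EuclideanSpace ℝ (Fin 3)) (ξ₀ : EuclideanSpace ℝ (Fin 3)) (τ₀ : ℝ), 0 < l₀ → τ₀ ≤ 0 → Ew (fun y => prof σ₀ w y - prof σ₀ (act l₀ R₀ ξ₀ τ₀ u) y) ≤ ENNReal.ofReal δ → ∃ (l : ℝ) (R : EuclideanSpace ℝ (Fin 3) ≃ₗᵢ[ℝ] EuclideanSpace ℝ (Fin 3)) (ξ : EuclideanSpace ℝ (Fin 3))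 (τ : ℝ), 0 < l ∧ τ ≤ 0 ∧ ∀ σ : ℝ, σ ≤ σ₀ → Ew (fun y => prof σ w y - prof σ (act l R ξ τ u) y) ≤ ENNReal.ofReal (c * Real.exp (-(η * (σ₀ - σ))) * δ))

/-- item stmt-NavierStokesRegularity-8560 · crux · rank 3 · open · by planner
why it might fail: No ∞-dim asymptotic-phase theorem exists (LiMuldowney1995/Smith1986: finite-dim, criterion on a region + closing lemma); K1 contracts toward finer scales but recurrence gives zoom-outs, the near-self-similarities lie in NON-compact G⁺ (l_n→∞; ξ_n,τ_n unbounded), and the limit identity must hold a.e.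
sources: LiMuldowney1995, Smith1986, LianYoung2012, Ma2022, BarreiraPesin2023, AlbrittonBarker2019
[crux] [card K2, instantiated to NS; the relative Pesin–Smith engine] K1 at the same rate C (inlined
as the let-bound hypothesis `SyncModSim C`) ⇒ every smooth profile (w,q,H) of 𝒦_C that is SINGULAR
at the origin and UNIFORMLY RECURRENT under scaling in L³_loc (Birkhoff: ∀ε ∀K compact ⊆ {t≤0} ∃L ∀a
∃σ∈[a,a+L]: ‖w_σ − w‖_{L³(K)} ≤ ε, verbatim the recurrence of route RecurrentProfiles) is invariant,
a.e. on the slab, under one similarity with dilation factor l>1: ∃ l>1, R, ξ, τ≤0 with l Rᵀw(l²t+τ,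
lRx+ξ) = w(t,x) a.e. — i.e. w is SS/RSS/DSS/RDSS about a centre (x*, t*≥0) (t*=0 forced for singular
w). Proof intended: recurrence gives zoom-outs w_{s_n}→w; K1 synchronises w_{s_n} with g_n·w, hence
w ≈ h_n·w with h_n = scale(e^{−s_n})∘g_n and error ≤ c e^{−ηs_n/2}δ uniformly on all scales ≤ s_n/2;
translation components of h_n are excluded by ε-regularity (a translate of a Type-I profile is
regular at the origin, quantitatively), and the approximate self-similarities are upgraded to one
exact factor by compactness of 𝒦_C (AlbrittonBarker2019 Lemma 2.2, PROVED in tree) — the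
asymptotic-phase/Pesin argument of LiMuldowney1995 (Smith's autonomous convergence theorem) and
LianYoung2012/Ma20 -/
@[route_item "route-NavierStokesRegularity-DulacContraction"]
def SynchronizationForcesSelfSimilarity : Prop :=
  let prof := fun (σ : ℝ) (w : ℝ → EuclideanSpace ℝ (Fin 3) → EuclideanSpace ℝ (Fin 3)) (y : EuclideanSpace ℝ (Fin 3)) => Literature.Analysis.FluidPDE.nsRescale (Real.exp σ) w (-1) y; let Ew := fun (f : EuclideanSpace ℝ (Fin 3) → EuclideanSpace ℝ (Fin 3)) => ∫⁻ y, ‖f y‖ₑ ^ 2 * ENNReal.ofReal ((1 + ‖y‖ ^ 2)⁻¹ ^ 2); let act := fun (l : ℝ) (R : EuclideanSpace ℝ (Fin 3) ≃ₗᵢ[ℝ] EuclideanSpace ℝ (Fin 3)) (ξ : EuclideanSpace ℝ (Fin 3)) (τ : ℝ) (w : ℝ → EuclideanSpace ℝ (Fin 3) → EuclideanSpace ℝ (Fin 3)) (t : ℝ) (x : EuclideanSpace ℝ (Fin 3)) => l • R.symm (w (l ^ 2 * t + τ) (l • R x + ξ)); let SyncModSim : ℝ → Prop := fun C => (∃ η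 c δ : ℝ, 0 < η ∧ 0 ≤ c ∧ 0 < δ ∧ ∀ (u : ℝ → EuclideanSpace ℝ (Fin 3) → EuclideanSpace ℝ (Fin 3)) (p : ℝ → EuclideanSpace ℝ (Fin 3) → ℝ) (G : ℝ → EuclideanSpace ℝ (Fin 3) → EuclideanSpace ℝ (Fin 3) →L[ℝ] EuclideanSpace ℝ (Fin 3)), Literature.Analysis.FluidPDE.IsSuitableWeakSolutionOn (Literature.Analysis.FluidPDE.slab (EuclideanSpace ℝ (Fin 3)) (Set.Iio 0) isOpen_Iio) 1 0 u p → Literature.Analysis.FluidPDE.HasWeakSpatialGradientOn (Literature.Analysis.FluidPDE.slab (EuclideanSpace ℝ (Fin 3)) (Set.Iio 0) isOpen_Iio) u G → Literature.Analysis.FluidPDE.typeIBound (Set.Iio (0 : ℝ) ×ˢ Set.univ) u p G < ⊤ → Literature.Analysis.FluidPDE.HasTypeITimeDecay C u → Literature.Analysis.FluidPDE.IsClassicalNSSolutionOn (Set.Iio 0) 1 0 u p → ∀ (w : ℝ → EuclideanSpace ℝ (Fin 3) → EuclideanSpace ℝ (Fin 3)) (q : ℝ → EuclideanSpace ℝ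 (Fin 3) → ℝ) (H : ℝ → EuclideanSpace ℝ (Fin 3) → EuclideanSpace ℝ (Fin 3) →L[ℝ] EuclideanSpace ℝ (Fin 3)), Literature.Analysis.FluidPDE.IsSuitableWeakSolutionOn (Literature.Analysis.FluidPDE.slab (EuclideanSpace ℝ (Fin 3)) (Set.Iio 0) isOpen_Iio) 1 0 w q → Literature.Analysis.FluidPDE.HasWeakSpatialGradientOn (Literature.Analysis.FluidPDE.slab (EuclideanSpace ℝ (Fin 3)) (Set.Iio 0) isOpen_Iio) w H → Literature.Analysis.FluidPDE.typeIBound (Set.Iio (0 : ℝ) ×ˢ Set.univ) w q H < ⊤ → Literature.Analysis.FluidPDE.HasTypeITimeDecay C w → Literature.Analysis.FluidPDE.IsClassicalNSSolutionOn (Set.Iio 0) 1 0 w q → ∀ (σ₀ l₀ : ℝ) (R₀ : EuclideanSpace ℝ (Fin 3) ≃ₗᵢ[ℝ] EuclideanSpace ℝ (Fin 3)) (ξ₀ : EuclideanSpace ℝ (Fin 3)) (τ₀ : ℝ), 0 < l₀ → τ₀ ≤ 0 → Ew (fun y => prof σ₀ w y - prof σ₀ (act l₀ R₀ ξ₀ τ₀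 u) y) ≤ ENNReal.ofReal δ → ∃ (l : ℝ) (R : EuclideanSpace ℝ (Fin 3) ≃ₗᵢ[ℝ] EuclideanSpace ℝ (Fin 3)) (ξ : EuclideanSpace ℝ (Fin 3)) (τ : ℝ), 0 < l ∧ τ ≤ 0 ∧ ∀ σ : ℝ, σ ≤ σ₀ → Ew (fun y => prof σ w y - prof σ (act l R ξ τ u) y) ≤ ENNReal.ofReal (c * Real.exp (-(η * (σ₀ - σ))) * δ)); ∀ C : ℝ, SyncModSim C → ∀ (w : ℝ → EuclideanSpace ℝ (Fin 3) → EuclideanSpace ℝ (Fin 3)) (q : ℝ → EuclideanSpace ℝ (Fin 3) → ℝ) (H : ℝ → EuclideanSpace ℝ (Fin 3) → EuclideanSpace ℝ (Fin 3) →L[ℝ] EuclideanSpace ℝ (Fin 3)), Literature.Analysis.FluidPDE.IsSuitableWeakSolutionOn (Literature.Analysis.FluidPDE.slab (EuclideanSpace ℝ (Fin 3)) (Set.Iio 0) isOpen_Iio) 1 0 w q → Literature.Analysis.FluidPDE.HasWeakSpatialGradientOn (Literature.Analysis.FluidPDE.slab (EuclideanSpace ℝ (Fin 3)) (Set.Iio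 0) isOpen_Iio) w H → Literature.Analysis.FluidPDE.typeIBound (Set.Iio (0 : ℝ) ×ˢ Set.univ) w q H < ⊤ → Literature.Analysis.FluidPDE.HasTypeITimeDecay C w → Literature.Analysis.FluidPDE.IsClassicalNSSolutionOn (Set.Iio 0) 1 0 w q → Literature.Analysis.FluidPDE.IsBackwardSingularPoint w 0 → (∀ ε : ℝ, 0 < ε → ∀ K : Set (ℝ × EuclideanSpace ℝ (Fin 3)), IsCompact K → K ⊆ Set.Iic (0 : ℝ) ×ˢ Set.univ → ∃ L : ℝ, 0 < L ∧ ∀ a : ℝ, ∃ σ ∈ Set.Icc a (a + L), MeasureTheory.eLpNorm (fun z : ℝ × EuclideanSpace ℝ (Fin 3) => Literature.Analysis.FluidPDE.nsRescale (Real.exp σ) w z.1 z.2 - w z.1 z.2) 3 (MeasureTheory.volume.restrict K) ≤ ENNReal.ofReal ε) → (∃ l : ℝ, 1 < l ∧ ∃ (R : EuclideanSpace ℝ (Fin 3) ≃ₗᵢ[ℝ] EuclideanSpace ℝ (Fin 3)) (ξ : EuclideanSpace ℝ (Fin 3)) (τ : ℝ), τ ≤ 0 ∧ (fun z : ℝ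 × EuclideanSpace ℝ (Fin 3) => act l R ξ τ w z.1 z.2) =ᵐ[MeasureTheory.volume.restrict (Set.Iio (0 : ℝ) ×ˢ Set.univ)] (fun z : ℝ × EuclideanSpace ℝ (Fin 3) => w z.1 z.2))

/-- item stmt-NavierStokesRegularity-8561 · crux · rank 4 · open · by planner
why it might fail: Contains Type-I λ-DSS Liouville for ALL λ>1 and the RSS/RDSS conjecture (arXiv:2607.09619 Conj 1.1; α≈1 open: no head-pressure max principle); all proved rungs (arXiv:1610.09464 Thm 1.3; PV Thms 1.4/1.6/1.7) assume SPACE–time decay C/(|x|+√−t), not implied by rate + 𝐈<∞; one RDSS profile kills it.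
sources: PineauVicol2026, arXiv:2607.09619, ChaeWolf2017RemovingDSS, arXiv:1610.09464, BradshawTsai2017CPDE, Tsai2018
[crux] [the self-similar wall in the A–B class] A smooth profile (w,q,H) of 𝒦_C (rate C) that is
invariant a.e. on the slab under a similarity with dilation factor l>1 (∃ l>1, R∈O(3), ξ, τ≤0: l
Rᵀw(l²t+τ,lRx+ξ) = w(t,x) a.e.; centre (x*,t*), t* = −τ/(l²−1) ≥ 0) is REGULAR at the space–time
origin. Cases: t*>0 — trivial (w bounded near t=0); t*=0, x*≠0 — regularity off the centre of a
Type-I (R)DSS solution (ChaeWolf2017RemovingDSS Thm 1.1 for DSS in L^p; to be redone in the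
local-energy class); t*=0, x*=0 — Tsai's Type-I λ-DSS conjecture for every λ>1 (Tsai2018 Conj. 8.8,
BradshawTsai2017CPDE OP 5.1; known for 1<λ<λ_*(C): ChaeWolf2017RemovingDSS Thm 1.3; SS:
NecasRuzickaSverak1996, Tsai1998) and Perelman's RSS/RDSS conjecture for every rotation (Tsai2018
Conj. 8.9; known for |α|≪1 and |α|≫1: PineauVicol2026 Thm 1.4). Fed by the named wall: support
WallImpliesRDSSLiouville. [difficulty: open-problem] -/
@[route_item "route-NavierStokesRegularity-DulacContraction"]
def RDSSLiouvilleInClass : Prop :=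
  let act := fun (l : ℝ) (R : EuclideanSpace ℝ (Fin 3) ≃ₗᵢ[ℝ] EuclideanSpace ℝ (Fin 3)) (ξ : EuclideanSpace ℝ (Fin 3)) (τ : ℝ) (w : ℝ → EuclideanSpace ℝ (Fin 3) → EuclideanSpace ℝ (Fin 3)) (t : ℝ) (x : EuclideanSpace ℝ (Fin 3)) => l • R.symm (w (l ^ 2 * t + τ) (l • R x + ξ)); ∀ (w : ℝ → EuclideanSpace ℝ (Fin 3) → EuclideanSpace ℝ (Fin 3)) (q : ℝ → EuclideanSpace ℝ (Fin 3) → ℝ) (H : ℝ → EuclideanSpace ℝ (Fin 3) → EuclideanSpace ℝ (Fin 3) →L[ℝ] EuclideanSpace ℝ (Fin 3)) (C : ℝ), Literature.Analysis.FluidPDE.IsSuitableWeakSolutionOn (Literature.Analysis.FluidPDE.slab (EuclideanSpace ℝ (Fin 3)) (Set.Iio 0) isOpen_Iio) 1 0 w q → Literature.Analysis.FluidPDE.HasWeakSpatialGradientOn (Literature.Analysis.FluidPDE.slab (EuclideanSpace ℝ (Fin 3)) (Set.Iio 0) isOpen_Iio) w H → Literature.Analysis.FluidPDE.typeIBound (Set.Iio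 (0 : ℝ) ×ˢ Set.univ) w q H < ⊤ → Literature.Analysis.FluidPDE.HasTypeITimeDecay C w → Literature.Analysis.FluidPDE.IsClassicalNSSolutionOn (Set.Iio 0) 1 0 w q → (∃ l : ℝ, 1 < l ∧ ∃ (R : EuclideanSpace ℝ (Fin 3) ≃ₗᵢ[ℝ] EuclideanSpace ℝ (Fin 3)) (ξ : EuclideanSpace ℝ (Fin 3)) (τ : ℝ), τ ≤ 0 ∧ (fun z : ℝ × EuclideanSpace ℝ (Fin 3) => act l R ξ τ w z.1 z.2) =ᵐ[MeasureTheory.volume.restrict (Set.Iio (0 : ℝ) ×ˢ Set.univ)] (fun z : ℝ × EuclideanSpace ℝ (Fin 3) => w z.1 z.2)) → ¬ Literature.Analysis.FluidPDE.IsBackwardSingularPoint w 0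

/-- item stmt-NavierStokesRegularity-0056 · crux · rank 5 · open · by planner
why it might fail: No theorem bounds a blow-up rate from above: Tao's averaged NS blows up at a Type-II rate (arXiv:1402.0290 §1), so structure-blind methods cannot prove it; axisymmetric Type-I blow-up is excluded (SereginSverak2009 Thm 1.1; arXiv:2607.09619 fn 6): ANY axisymmetric singularity (e.g. Hou) refutes it.
sources: Tao2016AveragedNS, SereginSverak2009, KNSS2009, Hou2022PotentiallySingularNS, arXiv:2304.04045, Seregin2012
If a finite-energy classical solution from a rapidly decaying datum has maximal lifespan T<∞ (no
classical extension past T), then ‖u(t)‖_∞ ≤ C (T−t)^{-1/2} eventually as t↑T (Leray's rate is the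
matching lower bound, leray_blowup_rate_top). The hardest and most informative crux: a
counterexample is a Type II singularity, i.e. ¬(Clay A). Known: lower bound c√ν (T−t)^{-1/2} (Leray
1934 §20); L³ must blow up (ESS 2003, Seregin 2012); only triple-log quantitative gain (Tao 2021). -/
@[route_item "route-NavierStokesRegularity-DulacContraction"]
def NoTypeII : Prop :=
  ∀ (ν T : ℝ), 0 < ν → 0 < T → ∀ (u : ℝ → EuclideanSpace ℝ (Fin 3) → EuclideanSpace ℝ (Fin 3)) (p : ℝ → EuclideanSpace ℝ (Fin 3) → ℝ), Literature.Analysis.FluidPDE.IsMaximalSmoothSolution ν 0 u p T → Literature.Analysis.FluidPDE.IsLerayHopfOn T ν 0 (u 0) u → Literature.Analysis.FluidPDE.HasRapidSpatialDecay (u 0) → Literature.Analysis.FluidPDE.IsTypeIBlowup u T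

/-- item stmt-NavierStokesRegularity-0055 · support · rank 9 · closed · proved by Summit.NavierStokesRegularity.NavierStokesRegularity.Theorems.typeICertificateLadder_noBlowupToClay_proof @ 8d57e70af7e2 (prover) · by planner
sources: KNSS2009, AlbrittonBarker2019, Leray1934, Fefferman2000
Given NoBlowup, build the Clay (A) solution: local finite-energy classical solution for smooth
divergence-free rapidly decaying data (Leray 1934 §III / Fujita–Kato 1964 + LPS smoothing), continue
past every T using NoBlowup, glue by weak–strong uniqueness (Prodi–Serrin), bounded energy from the
energy inequality, and convert with
Literature.Analysis.FluidPDE.isNavierStokesSolution_and_smooth_iff. Blow-up at spatial infinity is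
excluded by CKN ε-regularity applied far out. May take named Literature facts (leray_existence_R3,
ladyzhenskaya_prodi_serrin, weak_strong_uniqueness, fujita_kato_local) as hypotheses if the grounder
so rules. -/
@[route_item "route-NavierStokesRegularity-DulacContraction"]
def ClayFromNoBlowup : Prop :=
  (∀ (ν T : ℝ), 0 < ν → 0 < T → ∀ (u : ℝ → EuclideanSpace ℝ (Fin 3) → EuclideanSpace ℝ (Fin 3)) (p : ℝ → EuclideanSpace ℝ (Fin 3) → ℝ), Literature.Analysis.FluidPDE.IsClassicalNSSolutionOn (Set.Ico 0 T) ν 0 u p → Literature.Analysis.FluidPDE.IsLerayHopfOn T ν 0 (u 0) u → Literature.Analysis.FluidPDE.HasRapidSpatialDecay (u 0) → Literature.Analysis.FluidPDE.HasSmoothExtensionPast ν 0 u T) → NavierStokesRegularity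

/-- `ClayFromNoBlowup` holds: proved by `Summit.NavierStokesRegularity.NavierStokesRegularity.Theorems.typeICertificateLadder_noBlowupToClay_proof` @ 8d57e70af7e2. -/
theorem ClayFromNoBlowup_holds : ClayFromNoBlowup := _root_.Summit.NavierStokesRegularity.NavierStokesRegularity.Theorems.typeICertificateLadder_noBlowupToClay_proof

/-- item stmt-NavierStokesRegularity-1590 · support · rank 9 · closed · proved by Summit.NavierStokesRegularity.NavierStokesRegularity.Theorems.recurrentReduction_proof (prover) · by planner
sources: AlbrittonBarker2019, Lin1998, Furstenberg1981, GigaKohn1985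
[crux] REDUCTION TO RECURRENT PROFILES (card X1, minimal-set form; new structure theorem). If a
profile of the class of RecurrentLiouville (rate constant C) has a backward singular point at (0,0),
then some profile of the class with the same C is singular at (0,0) AND uniformly recurrent under
scaling in L³_loc(ℝ³×(−∞,0]). Sketch: 𝒮 := {profiles, 𝐈 ≤ M, rate C}, topology = L³ convergence of u
on every bounded parabolic ball with top time ≤ 0 (p,G carried along weakly; ∇p is pinned by the
equation and a time-only addition is excluded by the scale-invariant bounds). (i) 𝒮 is sequentially
compact: Lin's compactness = A–B Lemma 2.2, PROVED in tree
(Literature.Analysis.FluidPDE.SuitableCompactness_holds, limit_isSuitableWeakSolutionInBall) on each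
ball + diagonal; 𝐈 ≤ M survives by lower semicontinuity of A(esssup), C, D(mean-free, weak L^{3/2}),
E(weak L²); the a.e. rate bound is closed. (ii) (σ,u) ↦ nsRescale(e^σ)u is a jointly continuous
ℝ-action on 𝒮 (𝐈 and the rate are scale invariant — HasTypeITimeDecay.nsRescale —, suitability is
scale covariant). (iii) 𝒮_sing := {origin backward-singular} is invariant and CLOSED: persistence of
singularities = A–B Prop 2.3, PROVED in tree (Persi -/
@[route_item "route-NavierStokesRegularity-DulacContraction"]
def RecurrentReduction : Prop :=
  ∀ (u : ℝ → EuclideanSpace ℝ (Fin 3) → EuclideanSpace ℝ (Fin 3)) (p : ℝ → EuclideanSpace ℝ (Fin 3) → ℝ) (G : ℝ → EuclideanSpace ℝ (Fin 3) → EuclideanSpace ℝ (Fin 3) →L[ℝ] EuclideanSpace ℝ (Fin 3)) (C : ℝ), Literature.Analysis.FluidPDE.IsSuitableWeakSolutionOn (Literature.Analysis.FluidPDE.slab (EuclideanSpace ℝ (Fin 3)) (Set.Iio 0) isOpen_Iio) 1 0 u p → Literature.Analysis.FluidPDE.HasWeakSpatialGradientOn (Literature.Analysis.FluidPDE.slab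 (EuclideanSpace ℝ (Fin 3)) (Set.Iio 0) isOpen_Iio) u G → Literature.Analysis.FluidPDE.typeIBound (Set.Iio (0 : ℝ) ×ˢ Set.univ) u p G < ⊤ → Literature.Analysis.FluidPDE.HasTypeITimeDecay C u → Literature.Analysis.FluidPDE.IsBackwardSingularPoint u 0 → ∃ (w : ℝ → EuclideanSpace ℝ (Fin 3) → EuclideanSpace ℝ (Fin 3)) (q : ℝ → EuclideanSpace ℝ (Fin 3) → ℝ) (H : ℝ → EuclideanSpace ℝ (Fin 3) → EuclideanSpace ℝ (Fin 3) →L[ℝ] EuclideanSpace ℝ (Fin 3)), Literature.Analysis.FluidPDE.IsSuitableWeakSolutionOn (Literature.Analysis.FluidPDE.slab (EuclideanSpace ℝ (Fin 3)) (Set.Iio 0) isOpen_Iio) 1 0 w q ∧ Literature.Analysis.FluidPDE.HasWeakSpatialGradientOn (Literature.Analysis.FluidPDE.slab (EuclideanSpace ℝ (Fin 3)) (Set.Iio 0) isOpen_Iio) w H ∧ Literature.Analysis.FluidPDE.typeIBound (Set.Iio (0 : ℝ) ×ˢ Set.univ) w q H < ⊤ ∧ Literature.Analysis.FluidPDE.HasTypeITimeDecay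 C w ∧ Literature.Analysis.FluidPDE.IsBackwardSingularPoint w 0 ∧ (∀ ε : ℝ, 0 < ε → ∀ K : Set (ℝ × EuclideanSpace ℝ (Fin 3)), IsCompact K → K ⊆ Set.Iic (0 : ℝ) ×ˢ Set.univ → ∃ L : ℝ, 0 < L ∧ ∀ a : ℝ, ∃ σ ∈ Set.Icc a (a + L), MeasureTheory.eLpNorm (fun z : ℝ × EuclideanSpace ℝ (Fin 3) => Literature.Analysis.FluidPDE.nsRescale (Real.exp σ) w z.1 z.2 - w z.1 z.2) 3 (MeasureTheory.volume.restrict K) ≤ ENNReal.ofReal ε)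

/-- `RecurrentReduction` holds: proved by `Summit.NavierStokesRegularity.NavierStokesRegularity.Theorems.recurrentReduction_proof`. -/
theorem RecurrentReduction_holds : RecurrentReduction := _root_.Summit.NavierStokesRegularity.NavierStokesRegularity.Theorems.recurrentReduction_proof

/-- item stmt-NavierStokesRegularity-1591 · support · rank 9 · closed · proved by Summit.NavierStokesRegularity.NavierStokesRegularity.Theorems.typeIBlowupProfile_proof (prover) · by planner
sources: AlbrittonBarker2019, KNSS2009, SereginSverak2009, Seregin2012, Lin1998
[support] TYPE-I-RATE BLOW-UP GENERATES A PROFILE SINGULAR AT THE ORIGIN (glue into the A–B class;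
known mathematics, not yet one tree statement). Given ν>0 and a maximal classical solution (u,p) on
[0,T) (IsMaximalSmoothSolution), Leray–Hopf from a rapidly decaying datum, with IsTypeIBlowup u T:
(1) normalise ν=1 by scaling (cf. LocalLerayViscosityScaling); (2) T maximal ⇒ some z=(T,x₀) is a
BACKWARD SINGULAR POINT: L^∞-continuation of classical/Kato solutions + far-field boundedness from
finite energy via CKN ε-regularity + compactness of the closed ball — the in-tree pattern
exists_singularPoint_katoMaximalTime / exists_pos_eLpNorm_lt_top_of_forall_exists_cylinder with the
facts IsKatoSolutionOn.continuation_of_bounded, IsKatoSolutionOn.farField_bound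
(RusinSverakSingularPoint.lean); (3) the rate is L^{2,∞}_t L^∞_x near T, so AlbrittonBarker2019
Lemma 2.5 (weak Serrin ⇒ Type I, via the Morrey estimates of Lemma 2.6 / Seregin 2006–07) gives
𝐈(Q(z,1/2)) < ∞ for the suitable pair (u, p) (A–B Remark 3.2: the forward direction holds for the
L^∞ rate although the rate alone does not bound the scaled energies); (4) zoom in AT z: v_k(y,s) =
λ_k u(x₀+λ_k y, T+λ_k² s), λ_k→0, has 𝐈(v_k; Q -/
@[route_item "route-NavierStokesRegularity-DulacContraction"]
def TypeIBlowupProfile : Prop :=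
  ∀ (ν T : ℝ), 0 < ν → 0 < T → ∀ (u : ℝ → EuclideanSpace ℝ (Fin 3) → EuclideanSpace ℝ (Fin 3)) (p : ℝ → EuclideanSpace ℝ (Fin 3) → ℝ), Literature.Analysis.FluidPDE.IsMaximalSmoothSolution ν 0 u p T → Literature.Analysis.FluidPDE.IsLerayHopfOn T ν 0 (u 0) u → Literature.Analysis.FluidPDE.HasRapidSpatialDecay (u 0) → Literature.Analysis.FluidPDE.IsTypeIBlowup u T → ∃ (w : ℝ → EuclideanSpace ℝ (Fin 3) → EuclideanSpace ℝ (Fin 3)) (q : ℝ → EuclideanSpace ℝ (Fin 3) → ℝ) (H : ℝ → EuclideanSpace ℝ (Fin 3) → EuclideanSpace ℝ (Fin 3) →L[ℝ] EuclideanSpace ℝ (Fin 3)) (C : ℝ), Literature.Analysis.FluidPDE.IsSuitableWeakSolutionOn (Literature.Analysis.FluidPDE.slab (EuclideanSpace ℝ (Fin 3)) (Set.Iio 0) isOpen_Iio) 1 0 w q ∧ Literature.Analysis.FluidPDE.HasWeakSpatialGradientOn (Literature.Analysis.FluidPDE.slab (EuclideanSpace ℝ (Fin 3)) (Set.Iio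 0) isOpen_Iio) w H ∧ Literature.Analysis.FluidPDE.typeIBound (Set.Iio (0 : ℝ) ×ˢ Set.univ) w q H < ⊤ ∧ Literature.Analysis.FluidPDE.HasTypeITimeDecay C w ∧ Literature.Analysis.FluidPDE.IsBackwardSingularPoint w 0

-- `TypeIBlowupProfile` holds: proved by `Summit.NavierStokesRegularity.NavierStokesRegularity.Theorems.typeIBlowupProfile_proof` (its module imports this route file, so no `_holds` link can be stated here).

/-- item stmt-NavierStokesRegularity-8562 · support · rank 9 · closed · proved by Summit.NavierStokesRegularity.NavierStokesRegularity.Theorems.dulacContraction_smoothRepresentative_proof (prover) · by planner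
sources: Serrin1962, KNSS2009, CKN1982, Lin1998, Literature.Analysis.FluidPDE.KNSS2009_regularity_boundedWeak_ancient
[support] [glue between the a.e. class and its smooth interior representative] a profile (u,p,G) of
𝒦_C (rate C) admits (u',p',G') in 𝒦_C with the same C, classical on (−∞,0) (interior regularity of
locally bounded suitable weak solutions; the pressure is re-normalised to the Riesz-transform
pressure, the parasitic harmonic part being killed by typeIBound<∞), u' = u a.e. on the slab, and
the transfers (origin singular for u ⇒ for u') and (uniformly recurrent u ⇒ u') (both notions are
invariant under a.e. modification; stated as implications to keep the glue pure logic). [difficulty: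
M] -/
@[route_item "route-NavierStokesRegularity-DulacContraction"]
def SmoothRepresentative : Prop :=
  ∀ (u : ℝ → EuclideanSpace ℝ (Fin 3) → EuclideanSpace ℝ (Fin 3)) (p : ℝ → EuclideanSpace ℝ (Fin 3) → ℝ) (G : ℝ → EuclideanSpace ℝ (Fin 3) → EuclideanSpace ℝ (Fin 3) →L[ℝ] EuclideanSpace ℝ (Fin 3)) (C : ℝ), Literature.Analysis.FluidPDE.IsSuitableWeakSolutionOn (Literature.Analysis.FluidPDE.slab (EuclideanSpace ℝ (Fin 3)) (Set.Iio 0) isOpen_Iio) 1 0 u p → Literature.Analysis.FluidPDE.HasWeakSpatialGradientOn (Literature.Analysis.FluidPDE.slab (EuclideanSpace ℝ (Fin 3)) (Set.Iio 0) isOpen_Iio) u G → Literature.Analysis.FluidPDE.typeIBound (Set.Iio (0 : ℝ) ×ˢ Set.univ) u p G < ⊤ → Literature.Analysis.FluidPDE.HasTypeITimeDecay C u → ∃ (u' : ℝ → EuclideanSpace ℝ (Fin 3) → EuclideanSpace ℝ (Fin 3)) (p' : ℝ → EuclideanSpace ℝ (Fin 3) → ℝ) (G' : ℝ → EuclideanSpace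 ℝ (Fin 3) → EuclideanSpace ℝ (Fin 3) →L[ℝ] EuclideanSpace ℝ (Fin 3)), (Literature.Analysis.FluidPDE.IsSuitableWeakSolutionOn (Literature.Analysis.FluidPDE.slab (EuclideanSpace ℝ (Fin 3)) (Set.Iio 0) isOpen_Iio) 1 0 u' p' ∧ Literature.Analysis.FluidPDE.HasWeakSpatialGradientOn (Literature.Analysis.FluidPDE.slab (EuclideanSpace ℝ (Fin 3)) (Set.Iio 0) isOpen_Iio) u' G' ∧ Literature.Analysis.FluidPDE.typeIBound (Set.Iio (0 : ℝ) ×ˢ Set.univ) u' p' G' < ⊤ ∧ Literature.Analysis.FluidPDE.HasTypeITimeDecay C u') ∧ Literature.Analysis.FluidPDE.IsClassicalNSSolutionOn (Set.Iio 0) 1 0 u' p' ∧ ((fun z : ℝ × EuclideanSpace ℝ (Fin 3) => u' z.1 z.2) =ᵐ[MeasureTheory.volume.restrict (Set.Iio (0 : ℝ) ×ˢ Set.univ)] (fun z : ℝ × EuclideanSpace ℝ (Fin 3) => u z.1 z.2)) ∧ (Literature.Analysis.FluidPDE.IsBackwardSingularPoint u 0 → Literature.Analysis.FluidPDE.IsBackwardSingularPoint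 u' 0) ∧ ((∀ ε : ℝ, 0 < ε → ∀ K : Set (ℝ × EuclideanSpace ℝ (Fin 3)), IsCompact K → K ⊆ Set.Iic (0 : ℝ) ×ˢ Set.univ → ∃ L : ℝ, 0 < L ∧ ∀ a : ℝ, ∃ σ ∈ Set.Icc a (a + L), MeasureTheory.eLpNorm (fun z : ℝ × EuclideanSpace ℝ (Fin 3) => Literature.Analysis.FluidPDE.nsRescale (Real.exp σ) u z.1 z.2 - u z.1 z.2) 3 (MeasureTheory.volume.restrict K) ≤ ENNReal.ofReal ε) → (∀ ε : ℝ, 0 < ε → ∀ K : Set (ℝ × EuclideanSpace ℝ (Fin 3)), IsCompact K → K ⊆ Set.Iic (0 : ℝ) ×ˢ Set.univ → ∃ L : ℝ, 0 < L ∧ ∀ a : ℝ, ∃ σ ∈ Set.Icc a (a + L), MeasureTheory.eLpNorm (fun z : ℝ × EuclideanSpace ℝ (Fin 3) => Literature.Analysis.FluidPDE.nsRescale (Real.exp σ) u' z.1 z.2 - u' z.1 z.2) 3 (MeasureTheory.volume.restrict K) ≤ ENNReal.ofReal ε))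

-- `SmoothRepresentative` holds: proved by `Summit.NavierStokesRegularity.NavierStokesRegularity.Theorems.dulacContraction_smoothRepresentative_proof` (its module imports this route file, so no `_holds` link can be stated here).

/-- item stmt-NavierStokesRegularity-8564 · support · rank 9 · closed · proved by Summit.NavierStokesRegularity.NavierStokesRegularity.Theorems.dulacContraction_targetOfCruxes_proof (prover) · by planner
sources: AlbrittonBarker2019, Furstenberg1981
[support] [glue, pure logic, PROVED in Sketch.lean as targetOfCruxes_holds]
SynchronizationModSimilarity → SynchronizationForcesSelfSimilarity → RDSSLiouvilleInClass →
RecurrentReduction → SmoothRepresentative → NoTypeIRateProfile (by decl name, the template form; the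
decls precede it in the route file): a singular class profile yields a recurrent singular one, then
a smooth recurrent singular one, which K2(K1) makes RDSS and W makes regular — contradiction.
[difficulty: provable-now] -/
@[route_item "route-NavierStokesRegularity-DulacContraction"]
def TargetOfCruxes : Prop :=
  SynchronizationModSimilarity → SynchronizationForcesSelfSimilarity → RDSSLiouvilleInClass → RecurrentReduction → SmoothRepresentative → NoTypeIRateProfile

-- `TargetOfCruxes` holds: proved by `Summit.NavierStokesRegularity.NavierStokesRegularity.Theorems.dulacContraction_targetOfCruxes_proof` (its module imports this route file, so no `_holds` link can be stated here).

-- item stmt-NavierStokesRegularity-8569 · support · rank 9 · open · by planner — informal only, no Lean statement yet: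
--   [support] ABSTRACT ENGINE behind cruxes #2/#3 (Literature-grade, topic Dynamics; the card's K2 with
--   CORRECTED hypotheses; signature to be set by a grounder once the definition request
--   SecondAdditiveCompound lands). Setting: H a separable Hilbert (or Banach) space; G a compact Lie
--   group acting on H by linear isometries; Φ a local semiflow defined for times s ∈ [0,1] on a
--   neighbourhood U of a compact set K ⊂ H, commuting with G, with Φ_s K = K (entire orbits through
--   every point of K), Φ_s of class C^{1+α} on U with compact and injective derivative (backward
--   uniqueness); V(x) = T_x(G·x) ⊕ E(x) a

/-- item stmt-NavierStokesRegularity-8565 · assembly · rank 1 · closed · proved by Summit.NavierStokesRegularity.NavierStokesRegularity.Theorems.dulacContraction_assembly_proof (prover) · by planner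
sources: AlbrittonBarker2019, KNSS2009, Fefferman2000
[assembly] SynchronizationModSimilarity → SynchronizationForcesSelfSimilarity → RDSSLiouvilleInClass
→ RecurrentReduction → SmoothRepresentative → TypeIBlowupProfile → NoTypeII → ClayFromNoBlowup →
NavierStokesRegularity (by decl name, the template form; every hypothesis is an item of this route,
five of them shared verbatim with RecurrentProfiles/TypeILiouville). -/
@[route_item "route-NavierStokesRegularity-DulacContraction"]
def Assembly : Prop :=
  SynchronizationModSimilarity → SynchronizationForcesSelfSimilarity → RDSSLiouvilleInClass → RecurrentReduction → SmoothRepresentative → TypeIBlowupProfile → NoTypeII → ClayFromNoBlowup → NavierStokesRegularity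

-- `Assembly` holds: proved by `Summit.NavierStokesRegularity.NavierStokesRegularity.Theorems.dulacContraction_assembly_proof` (its module imports this route file, so no `_holds` link can be stated here).

/-! D-0027 §2.1 — DECIDING THEOREM (planner-authored via `route open/edit --closes-file`; by planner-rbadge-NavierStokesRegularity-DulacCon-3a964d25-g4-0 2026-08-15T16:15:54Z):
its hypotheses are this route's items and its conclusion the sub-problem Statement (glue_lint), and it elaborates with this file. -/

@[closes "route-NavierStokesRegularity-DulacContraction"] theorem closes (hK1 : SynchronizationModSimilarity) (hK2 : SynchronizationForcesSelfSimilarity)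
    (hW : RDSSLiouvilleInClass) (hRec : RecurrentReduction) (hRep : SmoothRepresentative)
    (hProf : TypeIBlowupProfile) (hII : NoTypeII) (hClay : ClayFromNoBlowup) :
    NavierStokesRegularity := by
  apply hClay
  intro ν T hν hT u p hcl hLH hdec
  by_contra hext
  have hTI : Literature.Analysis.FluidPDE.IsTypeIBlowup u T :=
    hII ν T hν hT u p ⟨hcl, hext⟩ hLH hdec
  -- Type-I blow-up ⇒ a profile of the Albritton–Barker class singular at the origin
  obtain ⟨w, q, H, C, hsw, hgr, hIb, hdecay, hsing⟩ :=
    hProf ν T hν hT u p ⟨hcl, hext⟩ hLH hdec hTI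
  -- ⇒ a uniformly recurrent singular profile with the same rate constant
  obtain ⟨w₁, q₁, H₁, hsw₁, hgr₁, hIb₁, hdec₁, hsing₁, hrec₁⟩ :=
    hRec w q H C hsw hgr hIb hdecay hsing
  -- ⇒ its smooth interior representative (still singular, still recurrent)
  obtain ⟨w₂, q₂, H₂, ⟨hsw₂, hgr₂, hIb₂, hdec₂⟩, hcl₂, -, hsingT, hrecT⟩ :=
    hRep w₁ q₁ H₁ C hsw₁ hgr₁ hIb₁ hdec₁
  have hsing₂ := hsingT hsing₁
  have hrec₂ := hrecT hrec₁
  -- K2 fed with K1 at rate C: the profile is invariant under a similarity with factor l > 1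
  have hss := hK2 C (hK1 C) w₂ q₂ H₂ hsw₂ hgr₂ hIb₂ hdec₂ hcl₂ hsing₂ hrec₂
  -- the self-similar wall: such a profile is regular at the origin — contradiction
  exact hW w₂ q₂ H₂ C hsw₂ hgr₂ hIb₂ hdec₂ hcl₂ hss hsing₂

end Summit.NavierStokesRegularity.NavierStokesRegularity.Theses.DulacContraction
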